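import Summits.QuantumFields.BalabanUV.T4Continuum.Support.NE7LocalGradientBootstrap
import Summits.QuantumFields.BalabanUV.T4Continuum.Support.NE7GradientCurrencyCovariant
import Summits.QuantumFields.BalabanUV.T4Continuum.Support.NE3EnergyShapes
import HarnessLib

/-!
# NE7 — THE GRADIENT LETTER OF THE CUBE CHART FROM ITS SUP LETTER, THE COVARIANT CURRENT AND THE LANDAU REACTION, LOCALLY (F300):
# on a sup-cube of radius `R₀` about `z`, a unitary gauge `u₀` with `U^{u₀} = e^{A}` and `‖A‖ ≤ ρ`, `U` with plaquettes within `ε`, covariant current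
# `‖(D*_U ∂U)‖ ≤ j` and flat divergence-gradient of `A` within `r` ⟹ `‖∇A‖ ≤ (6ρ + 14(d+1)ρ + 2(R₀−2)²(j + (d+1)ε((e^{2ρ}−1) + 2ε(2+ε)) + r))∕D₀`
# at depth `D₀ + 2`, under `32(d+1)(R₀ − 2)(e^{4ρ} − 1) ≤ 1` — no torus, no global gauge, no logarithm

Cell `pub-balaban`, rung (B)+1 sub-cell t4, lineage `b2b-balaban-t4-ne7-p1` (CRUX PROVER NE7 #1 = OWNER of row NE7), generation 92; memo
`t4/b2b-balaban-t4-ne7-p1-g92/LOG-OBSTRUCTION.md` §4 (ROAD (U), brick (B1)).  Over F299 `NE7LocalGradientBootstrap.norm_fdiff_le_of_plaqDiv_cube` (the distance-weighted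
interior bootstrap), lineage #2's (158) `NE7GradientCurrencyCovariant` (Banach-algebra defects, `covDiv_one_eq_sum_ite`), lit-balaban's [Balaban1985RegularSpaces] (1.2) ∕ (1.11)
`B8Ineq132.covDiv` ∕ `norm_covDiv_gaugeAct` and the locality lemma `B8Ineq130.hol_plaqWord_congr`.

WHY.  (158) `gradient_currency_of_covDiv` derives the gradient letter of a representative `A₀` (`U^{u₀} = e^{A₀}`) from its sup letter, the covariant flux
divergence of `U` and the Landau reaction — ON A TORUS, for a GLOBAL periodic `A₀`.  Route 1's chart is a CUBE chart (F298: [B11] Thm 1 (9) first-order letters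
on a cube of `M_c` blocks), and global charts on the torus are obstructed (torons, F287).  With F299's weighted bootstrap the same derivation now runs on a cube:
the plaquette-divergence datum of `W = e^{A}` at an interior site equals that of the genuine configuration `U^{u₀}` (locality of plaquette holonomies), which (158)'s
defect bookkeeping — here with the bond radius asked only on the `d+1` bonds `(x − e_μ, μ)` of the stencil — bounds by the gauge-INVARIANT current `‖covDiv 1 U‖`
plus second-order defects `(d+1)·ε·((e^{2ρ} − 1) + 2ε(2 + ε))`.  So the cube chart's GRADIENT letter — the one thing an axial gauge cannot give — follows from its
SUP letter, the current (for OUR tangent-critical configurations: F296 `NE7CovDivGeneralDatum`, `≲ t∕M³`) and the Landau reaction (zero in an exact lattice Landau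
gauge), with constants polynomial in the cube size: at `R₀ ≍ ℓM`, `ρ ≍ ℓt∕M`, `j ≍ t∕M³`, `ε ≍ t∕M²`, `D₀ = M` the bound is `≲ (ℓ + ℓ²)·t∕M²`, NO `log M`.
WHAT ([folklore]; 0 def, 0 sorry).  §1 `norm_plaqDivFlat_le_covDiv_local` ((158) §1 with the bond radius localised to the stencil).  §2
**`norm_fdiff_le_of_landauSup_cube`** (displayed above).
HONEST FRAMING (page 1): elementary lattice ∕ Banach-algebra analysis of OUR objects; the local gauge `u₀`, the sup letter `ρ`, the current bound `j` and the
reaction bound `r` are HYPOTHESES (no gauge constructed, no minimiser used); nothing of Bałaban's asserted; NE7 NOT PROVED; spine 0∕9; finite T⁴ rung (B)+1 —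
NOT infinite volume, NOT mass gap, NOT `BetaPertH`, NOT Clay.  Continuum YM on T⁴ ⇐ BetaPertH ∧ nine spine estimates (0/9 proved); BetaPertH ⇐ (D1) ∧ (D4) ∧
CAP+tail; G-an2-4 gates asym, D1 and NE2/3/4.  No `sorry`; axioms ⊆ {propext, Classical.choice, Quot.sound}.
-/

set_option autoImplicit false

open scoped BigOperators Matrix Matrix.Norms.L2Operator
open NormedSpace Finset

namespace Summit.QuantumFields.BalabanUV.T4Continuum.NE7CubeGradientOfLandauSup

open Literature.MathematicalPhysics.QuantumFieldTheory.Balaban1983to89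
open B7Prop1Explicit B7Prop2Explicit
open B7Eq78Linearization (conjR conjR_apply conjR_sub conjR_one)
open B7Prop1Local (AgreeOn InBox)
open B8Ineq130 (hol_plaqWord_congr)
open B8Ineq132 (covDiv plaqF norm_covDiv_gaugeAct)
open T4AveragingDeficitWall (vary SmallField)
open BlockAveragePushDirSplit (flat)
open AveragingDeficitTransport (mem_U1_of_unitary)
open NE3EnergyShapes (IsUnitarySite)
open NE3AxialGaugeLadder (smallField_gaugeAct)
open NE7GradientCurrency (vary_flat_one_apply)
open NE7GradientCurrencyCovariant (norm_conjR_sub_self_le norm_inv_sub_inv_add_sub_le hol_plaqWord_swap' covDiv_one_eq_sum_ite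
  norm_sum_le_norm_add_of_termwise norm_expUnit_sub_one_le')
open NE7LocalGradientBootstrap (norm_fdiff_le_of_plaqDiv_cube)

noncomputable section

variable {d : ℕ} {n : Type*} [Fintype n] [DecidableEq n] [Nonempty n]

/-! ## §1 (158) §1 with the bond radius on the stencil only -/

set_option maxHeartbeats 800000 in
/-- **THE FLAT CO-DIFFERENTIAL OF THE PLAQUETTE DEVIATION AGAINST THE COVARIANT DIVERGENCE (1.2), LOCAL BOND RADIUS**: as (158)
`NE7GradientCurrencyCovariant.norm_plaqDivFlat_le_covDiv`, but the bond radius `b₀` (of `W(b)` and `W(b)⁻¹`) is asked only on the `d` bonds `(x − e_μ, μ)` of the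
stencil at `x`: `‖Σ_μ [(W(∂p_{μν}(x)) − 1) − (W(∂p_{μν}(x−e_μ)) − 1)]‖ ≤ ‖covDiv 1 W ν x‖ + d·(ε·b₀·(2 + b₀) + 2ε²(2 + ε))`. [folklore] -/
theorem norm_plaqDivFlat_le_covDiv_local (W : Site d → Fin d → (Matrix n n ℂ)ˣ) {b₀ ε : ℝ} (hε0 : 0 ≤ ε) (hb0 : 0 ≤ b₀) (x : Site d)
    (hWb : ∀ μ : Fin d, ‖((W (x - e μ) μ : (Matrix n n ℂ)ˣ) : (Matrix n n ℂ)) - 1‖ ≤ b₀ ∧ ‖(((W (x - e μ) μ)⁻¹ : (Matrix n n ℂ)ˣ) : (Matrix n n ℂ)) - 1‖ ≤ b₀)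
    (hWε : SmallField W ε) (ν : Fin d) :
    ‖∑ μ, ((((hol W x (plaqWord μ ν) : (Matrix n n ℂ)ˣ) : (Matrix n n ℂ)) - 1) - (((hol W (x - e μ) (plaqWord μ ν) : (Matrix n n ℂ)ˣ) : (Matrix n n ℂ)) - 1))‖
      ≤ ‖covDiv 1 W ν x‖ + d * (ε * b₀ * (2 + b₀) + 2 * ε * ε * (2 + ε)) := by
  classical
  have hK0 : 0 ≤ 2 * ε * ε * (2 + ε) := mul_nonneg (mul_nonneg (mul_nonneg (by norm_num) hε0) hε0) (by linarith)
  -- transport defect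
  have htrans : ∀ (μ : Fin d) (Y : (Matrix n n ℂ)ˣ), ‖(Y : (Matrix n n ℂ)) - 1‖ ≤ ε →
      ‖conjR (W (x - e μ) μ)⁻¹ (Y : (Matrix n n ℂ)) - (Y : (Matrix n n ℂ))‖ ≤ ε * b₀ * (2 + b₀) := by
    intro μ Y hY
    have hV1 : ‖(((W (x - e μ) μ)⁻¹ : (Matrix n n ℂ)ˣ) : (Matrix n n ℂ)) - 1‖ ≤ b₀ := (hWb μ).2
    have hV2 : ‖((((W (x - e μ) μ)⁻¹)⁻¹ : (Matrix n n ℂ)ˣ) : (Matrix n n ℂ)) - 1‖ ≤ b₀ := by rw [inv_inv]; exact (hWb μ).1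
    have hV3 : ‖((((W (x - e μ) μ)⁻¹)⁻¹ : (Matrix n n ℂ)ˣ) : (Matrix n n ℂ))‖ ≤ 1 + b₀ := by
      have h := norm_le_norm_add_norm_sub' ((((W (x - e μ) μ)⁻¹)⁻¹ : (Matrix n n ℂ)ˣ) : (Matrix n n ℂ)) 1
      rw [norm_one] at h
      linarith
    have hid : conjR (W (x - e μ) μ)⁻¹ (Y : (Matrix n n ℂ)) - (Y : (Matrix n n ℂ)) = conjR (W (x - e μ) μ)⁻¹ ((Y : (Matrix n n ℂ)) - 1) - ((Y : (Matrix n n ℂ)) - 1) := by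
      rw [conjR_sub, conjR_one]; abel
    rw [hid]
    refine (norm_conjR_sub_self_le _ _).trans ?_
    calc (‖(((W (x - e μ) μ)⁻¹ : (Matrix n n ℂ)ˣ) : (Matrix n n ℂ)) - 1‖ * ‖((((W (x - e μ) μ)⁻¹)⁻¹ : (Matrix n n ℂ)ˣ) : (Matrix n n ℂ))‖
            + ‖((((W (x - e μ) μ)⁻¹)⁻¹ : (Matrix n n ℂ)ˣ) : (Matrix n n ℂ)) - 1‖) * ‖(Y : (Matrix n n ℂ)) - 1‖
        ≤ (b₀ * (1 + b₀) + b₀) * ε :=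
          mul_le_mul (add_le_add (mul_le_mul hV1 hV3 (norm_nonneg _) hb0) hV2) hY (norm_nonneg _) (by positivity)
      _ = ε * b₀ * (2 + b₀) := by ring
  refine norm_sum_le_norm_add_of_termwise
    (fun μ => (((hol W x (plaqWord μ ν) : (Matrix n n ℂ)ˣ) : (Matrix n n ℂ)) - 1) - (((hol W (x - e μ) (plaqWord μ ν) : (Matrix n n ℂ)ˣ) : (Matrix n n ℂ)) - 1))
    (fun μ => if μ < ν then conjR (W (x - e μ) μ)⁻¹ (plaqF W μ ν (x - e μ)) - plaqF W μ ν x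
      else if ν < μ then -(conjR (W (x - e μ) μ)⁻¹ (plaqF W ν μ (x - e μ)) - plaqF W ν μ x) else 0)
    (covDiv_one_eq_sum_ite W ν x) fun μ => ?_
  -- the termwise bound
  by_cases h1 : μ < ν
  · have hne : μ ≠ ν := ne_of_lt h1
    have hε : ‖((hol W (x - e μ) (plaqWord μ ν) : (Matrix n n ℂ)ˣ) : (Matrix n n ℂ)) - 1‖ ≤ ε := hWε (x - e μ) μ ν hne
    have hval : ((((hol W x (plaqWord μ ν) : (Matrix n n ℂ)ˣ) : (Matrix n n ℂ)) - 1) - (((hol W (x - e μ) (plaqWord μ ν) : (Matrix n n ℂ)ˣ) : (Matrix n n ℂ)) - 1))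
        + (if μ < ν then conjR (W (x - e μ) μ)⁻¹ (plaqF W μ ν (x - e μ)) - plaqF W μ ν x
            else if ν < μ then -(conjR (W (x - e μ) μ)⁻¹ (plaqF W ν μ (x - e μ)) - plaqF W ν μ x) else 0)
        = conjR (W (x - e μ) μ)⁻¹ (plaqF W μ ν (x - e μ)) - plaqF W μ ν (x - e μ) := by
      simp only [h1, ↓reduceIte, plaqF]; abel
    rw [hval]
    exact (htrans μ (hol W (x - e μ) (plaqWord μ ν)) hε).trans (le_add_of_nonneg_right hK0)
  · by_cases h2 : ν < μ
    · have hne : ν ≠ μ := ne_of_lt h2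
      have hne' : μ ≠ ν := hne.symm
      have hQi : hol W x (plaqWord μ ν) = (hol W x (plaqWord ν μ))⁻¹ := hol_plaqWord_swap' W x ν μ
      have hQ'i : hol W (x - e μ) (plaqWord μ ν) = (hol W (x - e μ) (plaqWord ν μ))⁻¹ := hol_plaqWord_swap' W (x - e μ) ν μ
      have eQ : ‖((hol W x (plaqWord ν μ) : (Matrix n n ℂ)ˣ) : (Matrix n n ℂ)) - 1‖ ≤ ε := hWε x ν μ hne
      have eQ' : ‖((hol W (x - e μ) (plaqWord ν μ) : (Matrix n n ℂ)ˣ) : (Matrix n n ℂ)) - 1‖ ≤ ε := hWε (x - e μ) ν μ hne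
      have eQi : ‖(((hol W x (plaqWord ν μ))⁻¹ : (Matrix n n ℂ)ˣ) : (Matrix n n ℂ)) - 1‖ ≤ ε := by rw [← hQi]; exact hWε x μ ν hne'
      have eQ'i : ‖(((hol W (x - e μ) (plaqWord ν μ))⁻¹ : (Matrix n n ℂ)ˣ) : (Matrix n n ℂ)) - 1‖ ≤ ε := by rw [← hQ'i]; exact hWε (x - e μ) μ ν hne'
      have hval : ((((hol W x (plaqWord μ ν) : (Matrix n n ℂ)ˣ) : (Matrix n n ℂ)) - 1) - (((hol W (x - e μ) (plaqWord μ ν) : (Matrix n n ℂ)ˣ) : (Matrix n n ℂ)) - 1))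
          + (if μ < ν then conjR (W (x - e μ) μ)⁻¹ (plaqF W μ ν (x - e μ)) - plaqF W μ ν x
              else if ν < μ then -(conjR (W (x - e μ) μ)⁻¹ (plaqF W ν μ (x - e μ)) - plaqF W ν μ x) else 0)
          = (((((hol W x (plaqWord ν μ))⁻¹ : (Matrix n n ℂ)ˣ) : (Matrix n n ℂ)) - (((hol W (x - e μ) (plaqWord ν μ))⁻¹ : (Matrix n n ℂ)ˣ) : (Matrix n n ℂ)))
              + (((hol W x (plaqWord ν μ) : (Matrix n n ℂ)ˣ) : (Matrix n n ℂ)) - ((hol W (x - e μ) (plaqWord ν μ) : (Matrix n n ℂ)ˣ) : (Matrix n n ℂ))))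
            - (conjR (W (x - e μ) μ)⁻¹ ((hol W (x - e μ) (plaqWord ν μ) : (Matrix n n ℂ)ˣ) : (Matrix n n ℂ))
                - ((hol W (x - e μ) (plaqWord ν μ) : (Matrix n n ℂ)ˣ) : (Matrix n n ℂ))) := by
        simp only [h1, h2, ↓reduceIte, plaqF, hQi, hQ'i]
        abel
      rw [hval]
      refine (norm_sub_le _ _).trans ?_
      have hA := norm_inv_sub_inv_add_sub_le eQi eQ'i
      have hB := htrans μ (hol W (x - e μ) (plaqWord ν μ)) eQ'
      have hQQ' : ‖((hol W x (plaqWord ν μ) : (Matrix n n ℂ)ˣ) : (Matrix n n ℂ)) - ((hol W (x - e μ) (plaqWord ν μ) : (Matrix n n ℂ)ˣ) : (Matrix n n ℂ))‖ ≤ 2 * ε := by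
        have h : ((hol W x (plaqWord ν μ) : (Matrix n n ℂ)ˣ) : (Matrix n n ℂ)) - ((hol W (x - e μ) (plaqWord ν μ) : (Matrix n n ℂ)ˣ) : (Matrix n n ℂ))
            = (((hol W x (plaqWord ν μ) : (Matrix n n ℂ)ˣ) : (Matrix n n ℂ)) - 1) - (((hol W (x - e μ) (plaqWord ν μ) : (Matrix n n ℂ)ˣ) : (Matrix n n ℂ)) - 1) := by abel
        rw [h]
        exact (norm_sub_le _ _).trans (by linarith)
      have hA' : ‖((((hol W x (plaqWord ν μ))⁻¹ : (Matrix n n ℂ)ˣ) : (Matrix n n ℂ)) - (((hol W (x - e μ) (plaqWord ν μ))⁻¹ : (Matrix n n ℂ)ˣ) : (Matrix n n ℂ)))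
            + (((hol W x (plaqWord ν μ) : (Matrix n n ℂ)ˣ) : (Matrix n n ℂ)) - ((hol W (x - e μ) (plaqWord ν μ) : (Matrix n n ℂ)ˣ) : (Matrix n n ℂ)))‖ ≤ 2 * ε * ε * (2 + ε) := by
        refine hA.trans ?_
        have hε2 : 0 ≤ ε * (2 + ε) := mul_nonneg hε0 (by linarith)
        calc ε * (2 + ε) * ‖((hol W x (plaqWord ν μ) : (Matrix n n ℂ)ˣ) : (Matrix n n ℂ)) - ((hol W (x - e μ) (plaqWord ν μ) : (Matrix n n ℂ)ˣ) : (Matrix n n ℂ))‖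
            ≤ ε * (2 + ε) * (2 * ε) := mul_le_mul_of_nonneg_left hQQ' hε2
          _ = 2 * ε * ε * (2 + ε) := by ring
      linarith
    · -- `μ = ν`: everything vanishes
      have hμν : μ = ν := le_antisymm (not_lt.mp h2) (not_lt.mp h1)
      subst hμν
      have hval : ((((hol W x (plaqWord μ μ) : (Matrix n n ℂ)ˣ) : (Matrix n n ℂ)) - 1) - (((hol W (x - e μ) (plaqWord μ μ) : (Matrix n n ℂ)ˣ) : (Matrix n n ℂ)) - 1))
          + (if μ < μ then conjR (W (x - e μ) μ)⁻¹ (plaqF W μ μ (x - e μ)) - plaqF W μ μ x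
              else if μ < μ then -(conjR (W (x - e μ) μ)⁻¹ (plaqF W μ μ (x - e μ)) - plaqF W μ μ x) else 0) = 0 := by
        simp only [lt_irrefl, ↓reduceIte, hol_plaqWord_self, Units.val_one, sub_self, add_zero]
      rw [hval, norm_zero]
      exact add_nonneg (mul_nonneg (mul_nonneg hε0 hb0) (by linarith)) hK0

/-! ## §2 The gradient letter on a cube from the sup letter, the covariant current and the Landau reaction -/

set_option maxHeartbeats 800000 in
/-- **THE GRADIENT LETTER OF A CUBE CHART FROM ITS SUP LETTER, THE COVARIANT CURRENT AND THE REACTION — LOCALLY, NO LOGARITHM.**  Let `U` be a configuration on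
`ℤ^{d+1}` with `SmallField U ε`, `u₀` a unitary site gauge and `A` a bond field with `U^{u₀}(y, κ) = e^{A(y,κ)}` and `‖A(y, κ)‖ ≤ ρ` for `|y − z|_∞ ≤ R₀` (`R₀ ≥ 3`),
covariant current `‖covDiv 1 U ν y‖ ≤ j` ([Balaban1985RegularSpaces] (1.2), `η = 1`) and flat divergence-gradient `‖div A(y + e_ν) − div A(y)‖ ≤ r` for `|y − z|_∞ ≤ R₀ − 2`,
and `32(d+1)(R₀ − 2)(e^{4ρ} − 1) ≤ 1`.  Then for every `y` with `|y − z|_∞ + D₀ + 2 ≤ R₀` (`D₀ ≥ 1`):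
`‖A(y + e_τ, κ) − A(y, κ)‖ ≤ (6ρ + 14(d+1)ρ + 2(R₀ − 2)²·(j + (d+1)·ε·((e^{2ρ} − 1) + 2ε(2 + ε)) + r))∕D₀`. [folklore] -/
theorem norm_fdiff_le_of_landauSup_cube {U : Site (d + 1) → Fin (d + 1) → (Matrix n n ℂ)ˣ} {ε : ℝ} (hε0 : 0 ≤ ε) (hUε : SmallField U ε)
    {u₀ : Site (d + 1) → (Matrix n n ℂ)ˣ} (hu₀ : IsUnitarySite u₀) {A : Site (d + 1) → Fin (d + 1) → Matrix n n ℂ}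
    (z : Site (d + 1)) (R₀ : ℕ) (hR₀ : 3 ≤ R₀) {ρ j r : ℝ} (hρ : 0 ≤ ρ) (hj : 0 ≤ j) (hr : 0 ≤ r)
    (hUA : ∀ (y : Site (d + 1)) (κ : Fin (d + 1)), (∀ i, |y i - z i| ≤ (R₀ : ℤ)) → gaugeAct u₀ U y κ = expUnit (A y κ))
    (hA : ∀ (y : Site (d + 1)) (κ : Fin (d + 1)), (∀ i, |y i - z i| ≤ (R₀ : ℤ)) → ‖A y κ‖ ≤ ρ)
    (hcov : ∀ (y : Site (d + 1)) (ν : Fin (d + 1)), (∀ i, |y i - z i| ≤ (R₀ : ℤ) - 2) → ‖covDiv 1 U ν y‖ ≤ j)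
    (hP : ∀ (y : Site (d + 1)) (ν : Fin (d + 1)), (∀ i, |y i - z i| ≤ (R₀ : ℤ) - 2) →
      ‖∑ μ, (A (y + e ν) μ - A (y + e ν - e μ) μ) - ∑ μ, (A y μ - A (y - e μ) μ)‖ ≤ r)
    (hs : 32 * ((d + 1 : ℕ) : ℝ) * ((R₀ - 2 : ℕ) : ℝ) * (Real.exp (4 * ρ) - 1) ≤ 1)
    (y : Site (d + 1)) (D₀ : ℕ) (hD₀ : 1 ≤ D₀) (hy : ∀ i, |y i - z i| + (D₀ : ℤ) + 2 ≤ (R₀ : ℤ)) (κ τ : Fin (d + 1)) :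
    ‖A (y + e τ) κ - A y κ‖
      ≤ (6 * ρ + 14 * ((d + 1 : ℕ) : ℝ) * ρ
          + 2 * ((R₀ - 2 : ℕ) : ℝ) ^ 2 * ((j + ((d + 1 : ℕ) : ℝ) * (ε * ((Real.exp (2 * ρ) - 1) + 2 * ε * (2 + ε)))) + r)) / D₀ := by
  -- the gauged configuration and its agreement with `e^{A}` on the cube
  set W : Site (d + 1) → Fin (d + 1) → (Matrix n n ℂ)ˣ := gaugeAct u₀ U with hW
  have hWε : SmallField W ε := smallField_gaugeAct hu₀ hUε
  have hagree : AgreeOn (z - fun _ => (R₀ : ℤ)) (z + fun _ => (R₀ : ℤ)) (vary (flat (d := d + 1) (n := n)) A 1) W := by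
    intro x κ' hx _
    have hx' : ∀ i, |x i - z i| ≤ (R₀ : ℤ) := fun i => by
      have h := hx i; simp only [Pi.sub_apply, Pi.add_apply] at h; rw [abs_le]; constructor <;> linarith [h.1, h.2]
    rw [vary_flat_one_apply]
    exact (hUA x κ' hx').symm
  have hbox : ∀ (x : Site (d + 1)), (∀ i, |x i - z i| ≤ (R₀ : ℤ)) → InBox (z - fun _ => (R₀ : ℤ)) (z + fun _ => (R₀ : ℤ)) x := fun x hx i => by
    have h := abs_le.mp (hx i); simp only [Pi.sub_apply, Pi.add_apply]; constructor <;> linarith [h.1, h.2]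
  have e1 : ∀ (a : Fin (d + 1)) (i : Fin (d + 1)), |(e a : Site (d + 1)) i| ≤ 1 := fun a i => by rw [e_apply]; split_ifs <;> simp
  -- points near an interior site stay in the cube
  have near1 : ∀ (x : Site (d + 1)) (a : Fin (d + 1)) (c : ℤ), (∀ i, |x i - z i| ≤ c) → ∀ i, |(x + e a) i - z i| ≤ c + 1 := fun x a c hx i => by
    have : |(x + e a) i - z i| ≤ |(e a : Site (d + 1)) i| + |x i - z i| := by
      rw [show (x + e a) i - z i = (e a : Site (d + 1)) i + (x i - z i) by simp; ring]; exact abs_add_le _ _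
    linarith [e1 a i, hx i]
  have near1m : ∀ (x : Site (d + 1)) (a : Fin (d + 1)) (c : ℤ), (∀ i, |x i - z i| ≤ c) → ∀ i, |(x - e a) i - z i| ≤ c + 1 := fun x a c hx i => by
    have : |(x - e a) i - z i| ≤ |(e a : Site (d + 1)) i| + |x i - z i| := by
      rw [show (x - e a) i - z i = -(e a : Site (d + 1)) i + (x i - z i) by simp; ring]
      exact (abs_add_le _ _).trans (by rw [abs_neg])
    linarith [e1 a i, hx i]
  -- plaquette holonomies of `e^{A}` and of `W` agree at sites of depth ≥ 2
  have hplaq : ∀ (x : Site (d + 1)) (a b : Fin (d + 1)), (∀ i, |x i - z i| ≤ (R₀ : ℤ) - 2) →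
      hol (vary (flat (d := d + 1) (n := n)) A 1) x (plaqWord a b) = hol W x (plaqWord a b) := fun x a b hx =>
    hol_plaqWord_congr hagree x a b (hbox x fun i => (hx i).trans (by linarith))
      (hbox _ fun i => by linarith [near1 (x + e a) b _ (near1 x a _ hx) i])
  have e3 : ∀ (μ a b : Fin (d + 1)) (i : Fin (d + 1)), |(-(e μ : Site (d + 1)) i + (e a : Site (d + 1)) i) + (e b : Site (d + 1)) i| ≤ 2 := by
    intro μ a b i
    rw [e_apply, e_apply, e_apply]; split_ifs <;> norm_num
  have hplaqm : ∀ (x : Site (d + 1)) (μ a b : Fin (d + 1)), (∀ i, |x i - z i| ≤ (R₀ : ℤ) - 2) →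
      hol (vary (flat (d := d + 1) (n := n)) A 1) (x - e μ) (plaqWord a b) = hol W (x - e μ) (plaqWord a b) := fun x μ a b hx =>
    hol_plaqWord_congr hagree (x - e μ) a b (hbox _ fun i => by linarith [near1m x μ _ hx i])
      (hbox _ fun i => by
        have h1 : |(x - e μ + e a + e b) i - z i| ≤ |x i - z i| + |(-(e μ : Site (d + 1)) i + (e a : Site (d + 1)) i) + (e b : Site (d + 1)) i| := by
          rw [show (x - e μ + e a + e b) i - z i = (x i - z i) + ((-(e μ : Site (d + 1)) i + (e a : Site (d + 1)) i) + (e b : Site (d + 1)) i) by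
            simp only [Pi.add_apply, Pi.sub_apply]; ring]
          exact abs_add_le _ _
        linarith [hx i, e3 μ a b i])
  -- the plaquette-divergence datum `J` on the cube of radius `R₀ − 2`
  have hR2 : ((R₀ - 2 : ℕ) : ℤ) = (R₀ : ℤ) - 2 := by push_cast [Nat.cast_sub (by omega : 2 ≤ R₀)]; ring
  have hJ : ∀ (x : Site (d + 1)) (ν : Fin (d + 1)), (∀ i, |x i - z i| ≤ ((R₀ - 2 : ℕ) : ℤ)) →
      ‖∑ μ, ((((hol (vary (flat (d := d + 1) (n := n)) A 1) x (plaqWord μ ν) : (Matrix n n ℂ)ˣ) : (Matrix n n ℂ)) - 1)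
              - (((hol (vary (flat (d := d + 1) (n := n)) A 1) (x - e μ) (plaqWord μ ν) : (Matrix n n ℂ)ˣ) : (Matrix n n ℂ)) - 1))‖
        ≤ j + ((d + 1 : ℕ) : ℝ) * (ε * ((Real.exp (2 * ρ) - 1) + 2 * ε * (2 + ε))) := by
    intro x ν hx
    rw [hR2] at hx
    have hsum : ∑ μ, ((((hol (vary (flat (d := d + 1) (n := n)) A 1) x (plaqWord μ ν) : (Matrix n n ℂ)ˣ) : (Matrix n n ℂ)) - 1)
              - (((hol (vary (flat (d := d + 1) (n := n)) A 1) (x - e μ) (plaqWord μ ν) : (Matrix n n ℂ)ˣ) : (Matrix n n ℂ)) - 1))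
        = ∑ μ, ((((hol W x (plaqWord μ ν) : (Matrix n n ℂ)ˣ) : (Matrix n n ℂ)) - 1) - (((hol W (x - e μ) (plaqWord μ ν) : (Matrix n n ℂ)ˣ) : (Matrix n n ℂ)) - 1)) :=
      Finset.sum_congr rfl fun μ _ => by rw [hplaq x μ ν hx, hplaqm x μ μ ν hx]
    rw [hsum]
    -- bond radius on the stencil from the sup letter
    have hWb : ∀ μ : Fin (d + 1), ‖((W (x - e μ) μ : (Matrix n n ℂ)ˣ) : (Matrix n n ℂ)) - 1‖ ≤ Real.exp ρ - 1 ∧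
        ‖(((W (x - e μ) μ)⁻¹ : (Matrix n n ℂ)ˣ) : (Matrix n n ℂ)) - 1‖ ≤ Real.exp ρ - 1 := fun μ => by
      have hxm : ∀ i, |(x - e μ) i - z i| ≤ (R₀ : ℤ) := fun i => by linarith [near1m x μ _ hx i]
      have hWx : W (x - e μ) μ = expUnit (A (x - e μ) μ) := by rw [hW]; exact hUA _ μ hxm
      rw [hWx]; exact norm_expUnit_sub_one_le' (hA _ μ hxm)
    have hb0 : 0 ≤ Real.exp ρ - 1 := by linarith [Real.add_one_le_exp ρ]
    have h := norm_plaqDivFlat_le_covDiv_local W hε0 hb0 x hWb hWε ν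
    have hcovW : ‖covDiv 1 W ν x‖ = ‖covDiv 1 U ν x‖ := by
      rw [hW]; exact norm_covDiv_gaugeAct 1 (fun w => mem_U1_of_unitary (hu₀ w)) U ν x
    rw [hcovW] at h
    refine h.trans ?_
    have he : Real.exp ρ - 1 + 2 = Real.exp ρ + 1 := by ring
    have hexp2 : ε * (Real.exp ρ - 1) * (2 + (Real.exp ρ - 1)) + 2 * ε * ε * (2 + ε) = ε * ((Real.exp (2 * ρ) - 1) + 2 * ε * (2 + ε)) := by
      rw [show (2 : ℝ) * ρ = ρ + ρ by ring, Real.exp_add]; ring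
    have hc := hcov x ν hx
    rw [hexp2]
    push_cast
    linarith
  -- F299 on the cube of radius `R₀ − 2`
  have hR1 : 1 ≤ R₀ - 2 := by omega
  have hJ0 : 0 ≤ j + ((d + 1 : ℕ) : ℝ) * (ε * ((Real.exp (2 * ρ) - 1) + 2 * ε * (2 + ε))) := by
    have : 0 ≤ Real.exp (2 * ρ) - 1 := by linarith [Real.add_one_le_exp (2 * ρ)]
    positivity
  have hy' : ∀ i, |y i - z i| + (D₀ : ℤ) ≤ ((R₀ - 2 : ℕ) : ℤ) := fun i => by rw [hR2]; linarith [hy i]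
  exact norm_fdiff_le_of_plaqDiv_cube (n := n) A z (R₀ - 2) hR1 hρ hJ0 hr (fun x κ' hx => hA x κ' fun i => by rw [hR2] at hx; linarith [hx i])
    hJ (fun x ν hx => hP x ν fun i => by rw [hR2] at hx; exact hx i) hs y D₀ hD₀ hy' κ τ

end

end Summit.QuantumFields.BalabanUV.T4Continuum.NE7CubeGradientOfLandauSup
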